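import Summits.SmoothPoincare4.SmoothPoincare4.Theorems.AcyclicBisectionExists.Negative.Closed
import Summits.SmoothPoincare4.SmoothPoincare4.Theorems.ContractibleTwistedDoubleStandard.Negative.DoubleBisection
import Literature.Topology.FourManifolds.HomotopyS4CompactProofs
import Literature.AlgebraicTopology.SingularHomology.LocalHomologyVanishing

/-!
# `AcyclicBisectionExists` — negative-side support (5/5): automatic connectedness of the halves;
# tightness at the round `S⁴`; `SmoothPoincare4 → AcyclicBisectionExists` (a kill is an exotic `S⁴`)

* §10b `Witness.connectedSpace₁_of_acyclic` / `connectedSpace₂_of_acyclic`: over a path-connected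
  `M`, BOTH halves of an acyclic witness are connected (pair sequence + Lefschetz + `H₀` detects
  components); `seam_connected_QHS_of_homotopyEquiv` (over `M ≃ₕ S⁴`: seam connected,
  `H₁ = H₂ = 0`, `dim H₃ = 1`, no extra hypothesis); `acyclic_iff_connected_and_seam`.
* §11 `hasAcyclicSteinBisection_sphere` (the ∃-body HOLDS at the round `S⁴`: hemisphere
  bisection by two standard Stein balls, via the sibling crux's `crux_hypotheses_at_sphere`),
  `Witness.transport` (diffeomorphism invariance), `acyclicBisectionExists_of_spc4 :
  SmoothPoincare4 → AcyclicBisectionExists`, `not_spc4_of_not_acyclicBisectionExists`,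
  `exotic_of_not_acyclicBisectionExists` — a refutation of the crux is literally an exotic 4-sphere.
-/

noncomputable section

-- the prescribed namespace `Summit.<P>.<Sub>.…` duplicates `SmoothPoincare4` (P = Sub)
set_option linter.dupNamespace false

open scoped Manifold ContDiff Topology ContinuousMap
open Set Function CategoryTheory CategoryTheory.Limits
open Literature.Geometry.Symplectic Literature.AlgebraicTopology.SingularHomology

namespace Summit.SmoothPoincare4.SmoothPoincare4.Theorems.AcyclicBisectionExists.Negative

open Summit.SmoothPoincare4.SmoothPoincare4.Theses.ConvexBisection

/-- Local notation: the model space `ℝ⁴`. -/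
local notation "𝔼4" => EuclideanSpace ℝ (Fin 4)
/-- Local notation: the round 4-sphere. -/
local notation "𝕊⁴" => (Metric.sphere (0 : EuclideanSpace ℝ (Fin 5)) 1)

/-! ## §10b Automatic connectedness of the halves of an ACYCLIC witness over a path-connected `M`
(so §8–§10 apply to the crux's witnesses with no extra hypothesis) -/

namespace Witness

open Literature.Topology.FourManifolds

variable {M : Type} [TopologicalSpace M] [ChartedSpace 𝔼4 M] (B : Witness M)
variable [T2Space M] [SecondCountableTopology M] [IsManifold (𝓡 4) ∞ M] [Nonempty M]

/-- **Both halves of an acyclic witness over a path-connected `M` are connected** (here: the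
first; the second by `swap`): `H₁(M, e₁W₁; ℚ) ≅ H₁(W₂, ∂W₂; ℚ) = 0` (Lefschetz, `H₃(W₂) = 0`)
makes `H₀(e₁W₁) → H₀(M) ≅ ℚ` injective, so all point classes of `e₁ W₁` agree and `H₀` detects
components (`preconnectedSpace_of_pointClass_eq`). [folklore] -/
theorem connectedSpace₁_of_acyclic [PathConnectedSpace M] (hB : B.Acyclic) : ConnectedSpace B.W₁ := by
  haveI := B.t2Space₁
  haveI : Nonempty B.W₁ := B.halves_nonempty.1
  -- `H₁(M, e₁W₁) = 0`
  haveI := B.isIso_relMap₂ ℚ ℚ 1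
  have hrel : IsZero (relativeSingularHomology ℚ ℚ M (range B.e₁) 1) :=
    (B.isZero_relHomology₂ hB.right (p := 3) (q := 1) (by norm_num) rfl).of_iso
      (asIso (relativeSingularHomology.map ℚ ℚ B.e₂CM B.mapsTo_e₂_boundary 1)).symm
  -- `H₀(e₁W₁) → H₀(M)` injective
  have hmono : Mono (singularHomology.map ℚ ℚ
      (⟨Subtype.val, continuous_subtype_val⟩ : C(↥(range B.e₁), M)) 0) :=
    (relativeSingularHomology.exact_δ_map ℚ ℚ (range B.e₁) 0).mono_g (hrel.eq_of_src _ _)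
  have hinj := (ModuleCat.mono_iff_injective _).mp hmono
  -- hence `e₁ W₁ ≃ₜ W₁` is preconnected
  haveI : LocallyPathConnectedSpace B.W₁ :=
    ChartedSpace.locallyPathConnectedSpace (EuclideanHalfSpace 4) B.W₁
  haveI : LocallyConnectedSpace ↥(range B.e₁) :=
    B.emb₁.isEmbedding.toHomeomorph.symm.locallyConnectedSpace
  haveI : PreconnectedSpace ↥(range B.e₁) := preconnectedSpace_of_pointClass_eq fun z z' => hinj (by
    rw [map_pointClass, map_pointClass]
    exact pointClass_eq_of_pathConnectedSpace _ _)
  haveI : PreconnectedSpace B.W₁ :=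
    ⟨by simpa using B.emb₁.isEmbedding.toHomeomorph.symm.isPreconnected_image.2 isPreconnected_univ⟩
  exact ⟨‹_›⟩

/-- The second half of an acyclic witness over a path-connected `M` is connected. [folklore] -/
theorem connectedSpace₂_of_acyclic [PathConnectedSpace M] (hB : B.Acyclic) : ConnectedSpace B.W₂ :=
  B.swap.connectedSpace₁_of_acyclic hB.swap

/-- **The seam of an acyclic witness over `M ≃ₕ S⁴` is a CONNECTED ℚ-homology 3-sphere, with
no connectedness hypothesis on the halves** (they are automatically connected,
`connectedSpace₁_of_acyclic`; `M` is path connected as a homotopy 4-sphere): connected,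
`H₁ = H₂ = 0`, `dim H₃ = 1` — the crux text's gloss "(⇔ seam a connected ℚHS³)", forward
direction, verbatim. [folklore] -/
theorem seam_connected_QHS_of_homotopyEquiv (e : M ≃ₕ 𝕊⁴) (hB : B.Acyclic) :
    IsConnected B.seam ∧ IsZero (singularHomology ℚ ℚ B.Bd₂ 1) ∧
      IsZero (singularHomology ℚ ℚ B.Bd₂ 2) ∧ Module.finrank ℚ (singularHomology ℚ ℚ B.Bd₂ 3) = 1 := by
  haveI : PathConnectedSpace 𝕊⁴ := pathConnectedSpace_sphere_four
  haveI : PathConnectedSpace M := pathConnectedSpace_of_homotopyEquiv e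
  haveI := B.connectedSpace₁_of_acyclic hB
  haveI := B.connectedSpace₂_of_acyclic hB
  exact ⟨B.isConnected_seam hB.left, B.isZero_homology_bd₂ hB.right (by norm_num) (by norm_num),
    B.isZero_homology_bd₂ hB.right (by norm_num) (by norm_num), B.finrank_homology_bd₂_three hB.right⟩

/-- **`acyclic_iff_seam_of_homotopyEquiv` without connectedness hypotheses in the forward
direction**: over `M ≃ₕ S⁴`, an acyclic witness has connected halves and a connected ℚHS³ seam;
conversely connected halves + seam ℚHS in degrees 1, 2 give acyclicity. [folklore] -/
theorem acyclic_iff_connected_and_seam (e : M ≃ₕ 𝕊⁴) :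
    B.Acyclic ↔ ConnectedSpace B.W₁ ∧ ConnectedSpace B.W₂ ∧
      IsZero (singularHomology ℚ ℚ B.Bd₁ 1) ∧ IsZero (singularHomology ℚ ℚ B.Bd₁ 2) := by
  haveI : PathConnectedSpace 𝕊⁴ := pathConnectedSpace_sphere_four
  haveI : PathConnectedSpace M := pathConnectedSpace_of_homotopyEquiv e
  constructor
  · intro hB
    exact ⟨B.connectedSpace₁_of_acyclic hB, B.connectedSpace₂_of_acyclic hB,
      B.isZero_homology_bd₁ hB.left (by norm_num) (by norm_num),
      B.isZero_homology_bd₁ hB.left (by norm_num) (by norm_num)⟩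
  · rintro ⟨h₁, h₂, hΓ₁, hΓ₂⟩
    exact (B.acyclic_iff_seam_of_homotopyEquiv e).2 ⟨hΓ₁, hΓ₂⟩

end Witness

/-! ## §11 TIGHTNESS and the kill criterion, formally: the ∃-body HOLDS at the round `S⁴`
(non-vacuity of the whole signature), witnesses transport along diffeomorphisms, hence
`SmoothPoincare4 → AcyclicBisectionExists` and `¬ AcyclicBisectionExists → ¬ SmoothPoincare4`
(a kill of this crux is literally an exotic 4-sphere) -/

section Tightness

open Literature.Topology.FourManifolds
open Summit.SmoothPoincare4.SmoothPoincare4.Theorems.ContractibleTwistedDoubleStandard.Negative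

/-- Local notation: the closed unit 4-ball. -/
local notation "𝔻⁴" => (Metric.closedBall (0 : EuclideanSpace ℝ (Fin 4)) 1)

/-- **TIGHTNESS / NON-VACUITY: the round `S⁴` has a ℚ-acyclic Stein bisection along a common
contact seam** — `S⁴ = 𝔻⁴ ∪_{S³} 𝔻⁴` by the two hemisphere embeddings, both halves the standard
Stein ball `(B⁴ ⊂ ℂ², J₀, |z|²)` (tree `steinStructureClosedBall`), the complex tangencies of the
two halves agreeing on the equator (the sibling crux's landed support theorem
`crux_hypotheses_at_sphere`, `Theorems/ContractibleTwistedDoubleStandard/Negative/DoubleBisection.lean`),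
and `𝔻⁴` contractible hence ℚ-acyclic.  So the crux's signature is satisfiable in the intended
way: it is neither junk-true nor junk-false at its basepoint. [folklore] -/
theorem hasAcyclicSteinBisection_sphere : HasAcyclicSteinBisection 𝕊⁴ := by
  obtain ⟨e₁, e₂, h1, h2, h3, h4, h5, h6⟩ := crux_hypotheses_at_sphere
  haveI : ContractibleSpace 𝔻⁴ := contractibleSpace_closedBall_four
  refine ⟨⟨𝔻⁴, 𝔻⁴, steinStructureClosedBall, steinStructureClosedBall, e₁, e₂, h1, h2, h3, h4, h5, h6⟩,
    fun k hk => ⟨?_, ?_⟩⟩ <;>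
    exact isZero_singularHomology_of_contractibleSpace ℚ ℚ (X := 𝔻⁴) (Nat.pos_iff_ne_zero.1 hk)

variable {M N : Type} [TopologicalSpace M] [ChartedSpace 𝔼4 M] [IsManifold (𝓡 4) ∞ M]
  [TopologicalSpace N] [ChartedSpace 𝔼4 N] [IsManifold (𝓡 4) ∞ N]

omit [IsManifold (𝓡 4) ∞ M] [IsManifold (𝓡 4) ∞ N] in
/-- Chain rule for pushed-forward subspaces: `d(Φ ∘ f)_x S = dΦ_{f x} (df_x S)`, with the
base point `p = f x` abstracted (so that two maps hitting the same seam point can be compared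
syntactically). [folklore] -/
theorem map_mfderiv_comp_diffeomorph (Φ : N ≃ₘ⟮𝓡 4, 𝓡 4⟯ M) {W : Type} [TopologicalSpace W]
    [ChartedSpace (EuclideanHalfSpace 4) W] {f : W → N} {x : W}
    (hf : MDifferentiableAt (𝓡∂ 4) (𝓡 4) f x) (S : Submodule ℝ 𝔼4) {p : N} (hp : f x = p) :
    Submodule.map (mfderiv (𝓡∂ 4) (𝓡 4) ((Φ : N → M) ∘ f) x).toLinearMap S =
      Submodule.map (mfderiv (𝓡 4) (𝓡 4) Φ p).toLinearMap
        (Submodule.map (mfderiv (𝓡∂ 4) (𝓡 4) f x).toLinearMap S) := by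
  subst hp
  have hΦ : MDifferentiableAt (𝓡 4) (𝓡 4) Φ (f x) := Φ.mdifferentiable (by simp) (f x)
  have h1 := congrArg (fun T : TangentSpace (𝓡∂ 4) x →L[ℝ] TangentSpace (𝓡 4) (Φ (f x)) =>
    Submodule.map T.toLinearMap S) (mfderiv_comp x hΦ hf)
  exact h1.trans (Submodule.map_comp _ _ _)

/-- **Witnesses transport along diffeomorphisms** `Φ : N ≅ M`: compose both embeddings with `Φ`;
the contact condition transports by the chain rule (`map_mfderiv_comp_diffeomorph`). [folklore] -/
def Witness.transport (B : Witness N) (Φ : N ≃ₘ⟮𝓡 4, 𝓡 4⟯ M) : Witness M where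
  W₁ := B.W₁
  W₂ := B.W₂
  J₁ := B.J₁
  J₂ := B.J₂
  e₁ := Φ ∘ B.e₁
  e₂ := Φ ∘ B.e₂
  emb₁ := B.emb₁.diffeomorph_comp Φ
  emb₂ := B.emb₂.diffeomorph_comp Φ
  cover := by
    rw [range_comp, range_comp, ← image_union, B.cover]
    exact image_univ_of_surjective Φ.surjective
  inter₁ := by
    have hinj : Function.Injective (Φ : N → M) := Φ.injective
    rw [range_comp, range_comp, ← image_inter hinj, B.inter₁, image_image]; rfl
  inter₂ := by
    have hinj : Function.Injective (Φ : N → M) := Φ.injective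
    rw [range_comp, range_comp, ← image_inter hinj, B.inter₂, image_image]; rfl
  contact w₁ w₂ h := by
    have h' : B.e₁ w₁ = B.e₂ w₂ := Φ.injective h
    have hd₁ : MDifferentiableAt (𝓡∂ 4) (𝓡 4) B.e₁ w₁ := B.emb₁.contMDiff.mdifferentiableAt (by simp)
    have hd₂ : MDifferentiableAt (𝓡∂ 4) (𝓡 4) B.e₂ w₂ := B.emb₂.contMDiff.mdifferentiableAt (by simp)
    rw [map_mfderiv_comp_diffeomorph Φ hd₁ _ h', map_mfderiv_comp_diffeomorph Φ hd₂ _ rfl]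
    exact congrArg _ (B.contact w₁ w₂ h')

/-- Transport preserves acyclicity (the halves do not change). [folklore] -/
theorem Witness.transport_acyclic {B : Witness N} (hB : B.Acyclic) (Φ : N ≃ₘ⟮𝓡 4, 𝓡 4⟯ M) :
    (B.transport Φ).Acyclic := hB

/-- `HasAcyclicSteinBisection` is a diffeomorphism invariant. [folklore] -/
theorem hasAcyclicSteinBisection_of_diffeomorph (Φ : N ≃ₘ⟮𝓡 4, 𝓡 4⟯ M)
    (h : HasAcyclicSteinBisection N) : HasAcyclicSteinBisection M := by
  obtain ⟨B, hB⟩ := h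
  exact ⟨B.transport Φ, Witness.transport_acyclic hB Φ⟩

end Tightness

/-- **The crux is implied by the summit**: `SmoothPoincare4 → AcyclicBisectionExists` (transport
the `S⁴` witness along the diffeomorphism `M ≅ S⁴`).  With the route's deciding theorem
(`AcyclicBisectionExists → AcyclicBisectionRigidity → SmoothPoincare4`), the pair of cruxes is
exactly as strong as SPC4. [folklore] -/
theorem acyclicBisectionExists_of_spc4 (h : _root_.SmoothPoincare4) : AcyclicBisectionExists := by
  rw [acyclicBisectionExists_iff]
  intro M _ _ _ _ _ e
  obtain ⟨Φ⟩ := h M ‹_› ‹_› e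
  exact hasAcyclicSteinBisection_of_diffeomorph Φ.symm hasAcyclicSteinBisection_sphere

/-- **KILL CRITERION, formally: a refutation of this crux is an exotic 4-sphere.** [folklore] -/
theorem not_spc4_of_not_acyclicBisectionExists (h : ¬ AcyclicBisectionExists) : ¬ _root_.SmoothPoincare4 :=
  fun hs => h (acyclicBisectionExists_of_spc4 hs)

/-- The exotic sphere extracted from a kill: some smooth `M ≃ₕ S⁴` with NO ℚ-acyclic Stein
bisection along a common contact seam — in particular not diffeomorphic to `S⁴`. [folklore] -/
theorem exotic_of_not_acyclicBisectionExists (h : ¬ AcyclicBisectionExists) :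
    ∃ (M : Type) (_ : TopologicalSpace M) (_ : T2Space M) (_ : SecondCountableTopology M)
      (_ : ChartedSpace 𝔼4 M) (_ : IsManifold (𝓡 4) ∞ M),
      Nonempty (M ≃ₕ 𝕊⁴) ∧ ¬ HasAcyclicSteinBisection M ∧ IsEmpty (M ≃ₘ⟮𝓡 4, 𝓡 4⟯ 𝕊⁴) := by
  rw [acyclicBisectionExists_iff] at h
  simp only [not_forall] at h
  obtain ⟨M, _, _, _, _, _, e, hM⟩ := h
  refine ⟨M, ‹_›, ‹_›, ‹_›, ‹_›, ‹_›, ⟨e⟩, hM, ⟨fun Φ => hM ?_⟩⟩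
  exact hasAcyclicSteinBisection_of_diffeomorph Φ.symm hasAcyclicSteinBisection_sphere

end Summit.SmoothPoincare4.SmoothPoincare4.Theorems.AcyclicBisectionExists.Negative
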